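import Mathlib
import Literature.NumberTheory.Automorphic.TwistedQuotientConeDescentRows
import HarnessLib

/-!
# Averaging an invariant form over a finite-index overgroup —
crux `HeckeEigenvalueField` (stmt-Langlands-13632), line `Sketch`, stub AVG

Namespace `Summit.Langlands.Langlands.Theorems.HeckeEigenvalueField.Res`.  Theorems only.
For a group `G` acting on the real normed space `W` through `a : G →* (W →L[ℝ] W)` and on the complex
coefficient space `V` through `ρ`, the twisted pull-back of an alternating `r`-form `M` by `g` is
`actAlt ρ a g r M = ρ(g) ∘ M ∘ ∧ʳ a(g⁻¹)` (tree file `TwistedQuotientConeDescentRows`).  Given a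
finite-index subgroup `H ≤ G`, a `G`-stable open `X ⊆ W`, a form `β` which is `C^∞` on `X`,
`H`-invariant on `X` and has exterior derivative `dβ = ω` on `X` for a `G`-invariant `ω`,
`stub_average_invariant` proves that the transfer average
`β̄(x) = [G:H]⁻¹ ∑_{c ∈ G/H} actAlt c.out (β (a c.out⁻¹ x))` is `C^∞` on `X`, `G`-invariant on `X`, and
satisfies `dβ̄ = ω` on `X`; and that the summands do not depend on the coset representatives.
Ingredients: `actAlt (g h) = actAlt g ∘ actAlt h`; reindexing the sum by `c ↦ g • c`;
`d` commutes with the twisted pull-back at points of differentiability (Mathlib `extDeriv_pullback`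
for the linear map `a g⁻¹`, then postcomposition by the real-linear `ρ(g)`), adapted from the tree's
`famD_famAct_apply`.
Reference: K. S. Brown, *Cohomology of groups*, GTM 87 (1982), III §9. [Brown1982CohomologyGroups]
-/

set_option linter.dupNamespace false -- project-wide: `Summit.Langlands.Langlands` is the mandated namespace

noncomputable section

open Set Filter Topology
open Literature.NumberTheory.Automorphic Literature.NumberTheory.Automorphic.TwistedQuotient

namespace Summit.Langlands.Langlands.Theorems.HeckeEigenvalueField.Res

section AvgHelpers

variable {G : Type} [Group G]
  {V : Type} [NormedAddCommGroup V] [NormedSpace ℂ V] [FiniteDimensional ℂ V]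
  {W : Type} [NormedAddCommGroup W] [NormedSpace ℝ W]
  (ρ : Representation ℂ G V) (a : G →* (W →L[ℝ] W))

omit [FiniteDimensional ℂ V] in
/-- `a (g k)⁻¹ x = a k⁻¹ (a g⁻¹ x)`. [folklore] -/
theorem avg_act_mul_inv (g k : G) (x : W) : a (g * k)⁻¹ x = a k⁻¹ (a g⁻¹ x) := by
  rw [mul_inv_rev, map_mul]
  rfl

/-- The twisted pull-back is an action: `actAlt (g k) = actAlt g ∘ actAlt k`. [folklore] -/
theorem avg_actAlt_mul (g k : G) (r : ℕ) (M : W [⋀^Fin r]→L[ℝ] V) :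
    actAlt ρ a (g * k) r M = actAlt ρ a g r (actAlt ρ a k r M) := by
  ext v
  simp [actAlt_apply]

/-- The twisted pull-back `x ↦ actAlt g (β (a g⁻¹ x))` of a form which is `C^n` on the `G`-stable
set `X` is `C^n` on `X` (composition with the linear `a g⁻¹`, then a continuous linear operation
on forms). [folklore] -/
theorem avg_contDiffOn_actAlt {X : Set W} (hmaps : ∀ g : G, MapsTo (a g) X X) {r : ℕ}
    {n : WithTop ℕ∞} {β : W → W [⋀^Fin r]→L[ℝ] V} (hβs : ContDiffOn ℝ n β X) (g : G) :
    ContDiffOn ℝ n (fun y => actAlt ρ a g r (β (a g⁻¹ y))) X := by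
  have h1 : ContDiffOn ℝ n (fun y => β (a g⁻¹ y)) X :=
    hβs.comp (a g⁻¹).contDiff.contDiffOn (hmaps g⁻¹)
  exact ((ContinuousLinearMap.compContinuousAlternatingMapCLM ℝ W V V (Fin r) (ρCLM ρ g)).comp
    (ContinuousAlternatingMap.compContinuousLinearMapCLM (a g⁻¹))).contDiff.comp_contDiffOn h1

-- adapted from `Literature.NumberTheory.Automorphic.TwistedQuotient.famD_famAct_apply`
/-- **`d` commutes with the twisted pull-back** at points of differentiability (`A = a g⁻¹`
linear: `d((T ∘ β ∘ A) ∘ ∧A) = T ∘ (dβ ∘ A) ∘ ∧A`, Mathlib `extDeriv_pullback`).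
[cite: BottTu1982Forms, §I.1] -/
theorem avg_extDeriv_actAlt {r : ℕ} (β : W → W [⋀^Fin r]→L[ℝ] V) (g : G) {x : W}
    (hβ : DifferentiableAt ℝ β (a g⁻¹ x)) :
    extDeriv (fun y => actAlt ρ a g r (β (a g⁻¹ y))) x =
      actAlt ρ a g (r + 1) (extDeriv β (a g⁻¹ x)) := by
  set A : W →L[ℝ] W := a g⁻¹
  set T : V →L[ℝ] V := ρCLM ρ g
  -- the pullback `y ↦ (β (A y)).compCLM A`, then postcomposition by `T`
  have hpull : extDeriv (fun y => (β (A y)).compContinuousLinearMap A) x =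
      (extDeriv β (A x)).compContinuousLinearMap A := by
    have h2 : minSmoothness ℝ 2 ≤ (2 : WithTop ℕ∞) := by simp
    have h := extDeriv_pullback (ω := β) (f := fun y => A y) (x := x) (r := 2)
      (by simpa using hβ) A.contDiff.contDiffAt h2
    simpa only [ContinuousLinearMap.fderiv] using h
  have hA : DifferentiableAt ℝ (fun y => A y) x := A.differentiableAt
  have hdiff : DifferentiableAt ℝ (fun y => (β (A y)).compContinuousLinearMap A) x :=
    (hβ.comp x hA).continuousAlternatingMapCompContinuousLinearMap (differentiableAt_const A)
  have hpost : extDeriv (fun y => T.compContinuousAlternatingMap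
      ((β (A y)).compContinuousLinearMap A)) x =
      T.compContinuousAlternatingMap (extDeriv (fun y => (β (A y)).compContinuousLinearMap A) x) := by
    simp only [extDeriv]
    have hT := ((ContinuousLinearMap.compContinuousAlternatingMapCLM ℝ W V V (Fin r) T).hasFDerivAt.comp
      x hdiff.hasFDerivAt).fderiv
    rw [show (fun y => T.compContinuousAlternatingMap ((β (A y)).compContinuousLinearMap A)) =
        (ContinuousLinearMap.compContinuousAlternatingMapCLM ℝ W V V (Fin r) T) ∘
          fun y => (β (A y)).compContinuousLinearMap A from rfl, hT, alternatizeUncurryFin_postcomp]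
  change extDeriv (fun y => T.compContinuousAlternatingMap ((β (A y)).compContinuousLinearMap A)) x = _
  rw [hpost, hpull]
  rfl

end AvgHelpers

/-- **Stub AVG — averaging an invariant form over a finite-index overgroup.**  If `β` is smooth on the
`G`-stable open `X`, invariant under the finite-index subgroup `H` (twisted pull-back `actAlt`), with
`dβ = ω` on `X` for a `G`-invariant `ω`, then the average over `G ⧸ H` of the twisted pull-backs of `β`
(representatives `Quotient.out`; `βbar` given through `hβbar`, a `finsum` over the finite `G ⧸ H`) is smooth and
`G`-invariant on `X` with the same exterior derivative `ω`; moreover the twisted pull-back of `β` by `g`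
only depends on the coset `g H` (on `X`).  Transfer argument: `actAlt (g h) = actAlt g ∘ actAlt h` and
`H`-invariance make the summands independent of the representatives, `G` permutes the cosets, and `d`
commutes with finite sums and with the twisted pull-back.
[cite: Brown1982CohomologyGroups, III §9 (transfer)] [folklore] -/
theorem stub_average_invariant
    {G : Type} [Group G] (H : Subgroup G) [H.FiniteIndex]
    {V : Type} [NormedAddCommGroup V] [NormedSpace ℂ V] [FiniteDimensional ℂ V]
    {W : Type} [NormedAddCommGroup W] [NormedSpace ℝ W] [FiniteDimensional ℝ W]
    (ρ : Representation ℂ G V) (a : G →* (W →L[ℝ] W)) {X : Set W} (hXo : IsOpen X)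
    (hmaps : ∀ g : G, Set.MapsTo (a g) X X) {r : ℕ}
    (β : W → W [⋀^Fin r]→L[ℝ] V) (ω : W → W [⋀^Fin (r + 1)]→L[ℝ] V)
    (hβs : ContDiffOn ℝ ((⊤ : ℕ∞) : WithTop ℕ∞) β X)
    (hβH : ∀ h : G, h ∈ H → ∀ x ∈ X, TwistedQuotient.actAlt ρ a h r (β (a h⁻¹ x)) = β x)
    (hβd : ∀ x ∈ X, extDeriv β x = ω x)
    (hωG : ∀ g : G, ∀ x ∈ X, TwistedQuotient.actAlt ρ a g (r + 1) (ω (a g⁻¹ x)) = ω x)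
    (βbar : W → W [⋀^Fin r]→L[ℝ] V)
    (hβbar : ∀ x, βbar x =
      ((H.index : ℝ)⁻¹) • ∑ᶠ c : G ⧸ H, TwistedQuotient.actAlt ρ a c.out r (β (a c.out⁻¹ x))) :
    ContDiffOn ℝ ((⊤ : ℕ∞) : WithTop ℕ∞) βbar X ∧
      (∀ g : G, ∀ x ∈ X, TwistedQuotient.actAlt ρ a g r (βbar (a g⁻¹ x)) = βbar x) ∧
      (∀ x ∈ X, extDeriv βbar x = ω x) ∧
      ∀ x ∈ X, ∀ (g : G), TwistedQuotient.actAlt ρ a g r (β (a g⁻¹ x)) =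
        TwistedQuotient.actAlt ρ a ((g : G ⧸ H).out) r (β (a ((g : G ⧸ H).out)⁻¹ x)) := by
  haveI : Fintype (G ⧸ H) := Fintype.ofFinite _
  -- right `H`-translates of the representative do not change the twisted pull-back on `X`
  have hH : ∀ g k : G, k ∈ H → ∀ x ∈ X,
      actAlt ρ a (g * k) r (β (a (g * k)⁻¹ x)) = actAlt ρ a g r (β (a g⁻¹ x)) := by
    intro g k hk x hx
    rw [avg_actAlt_mul, avg_act_mul_inv, hβH k hk _ (hmaps g⁻¹ hx)]
  -- (iv) independence of the representative
  have hout : ∀ x ∈ X, ∀ (g : G), actAlt ρ a g r (β (a g⁻¹ x)) =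
      actAlt ρ a ((g : G ⧸ H).out) r (β (a ((g : G ⧸ H).out)⁻¹ x)) := by
    intro x hx g
    obtain ⟨k, hk⟩ := QuotientGroup.mk_out_eq_mul H g
    rw [hk, hH g k k.2 x hx]
  -- the average as a finite sum
  have hβbar' : ∀ y, βbar y =
      (H.index : ℝ)⁻¹ • ∑ c : G ⧸ H, actAlt ρ a c.out r (β (a c.out⁻¹ y)) := by
    intro y
    rw [hβbar, finsum_eq_sum_of_fintype]
  have hfun : βbar = fun y => (H.index : ℝ)⁻¹ • ∑ c : G ⧸ H, actAlt ρ a c.out r (β (a c.out⁻¹ y)) :=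
    funext hβbar'
  -- smoothness of each summand on `X`
  have hF : ∀ k : G, ContDiffOn ℝ ((⊤ : ℕ∞) : WithTop ℕ∞) (fun y => actAlt ρ a k r (β (a k⁻¹ y))) X :=
    fun k => avg_contDiffOn_actAlt ρ a hmaps hβs k
  refine ⟨?_, ?_, ?_, hout⟩
  · -- (i) smoothness
    rw [hfun]
    exact ContDiffOn.const_smul _ (ContDiffOn.sum fun c _ => hF c.out)
  · -- (ii) `G`-invariance: push `actAlt g` inside, combine, and reindex by `c ↦ g • c`
    intro g x hx
    rw [hβbar' (a g⁻¹ x), hβbar' x, actAlt_smul, map_sum]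
    congr 1
    have hmk : ∀ c : G ⧸ H, (QuotientGroup.mk (g * c.out) : G ⧸ H) = g • c := fun c =>
      MulAction.Quotient.mk_smul_out H g c
    calc ∑ c : G ⧸ H, actAlt ρ a g r (actAlt ρ a c.out r (β (a c.out⁻¹ (a g⁻¹ x))))
        = ∑ c : G ⧸ H, actAlt ρ a (g • c).out r (β (a (g • c).out⁻¹ x)) := by
          refine Finset.sum_congr rfl fun c _ => ?_
          rw [← avg_act_mul_inv, ← avg_actAlt_mul, hout x hx (g * c.out), hmk]
      _ = ∑ c : G ⧸ H, actAlt ρ a c.out r (β (a c.out⁻¹ x)) :=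
          Fintype.sum_equiv (MulAction.toPerm g) _ _ fun c => rfl
  · -- (iii) `d β̄ = ω`: `d` through the scalar and the finite sum, then through each pull-back
    intro x hx
    have hdF : ∀ k : G, DifferentiableAt ℝ (fun y => actAlt ρ a k r (β (a k⁻¹ y))) x := fun k =>
      ((hF k).contDiffAt (hXo.mem_nhds hx)).differentiableAt (by simp)
    have hdβ : ∀ k : G, DifferentiableAt ℝ β (a k⁻¹ x) := fun k =>
      (hβs.contDiffAt (hXo.mem_nhds (hmaps k⁻¹ hx))).differentiableAt (by simp)
    have hterm : ∀ c : G ⧸ H,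
        extDeriv (fun y => actAlt ρ a c.out r (β (a c.out⁻¹ y))) x = ω x := fun c => by
      rw [avg_extDeriv_actAlt ρ a β c.out (hdβ c.out), hβd _ (hmaps _ hx), hωG c.out x hx]
    rw [hfun]
    change extDeriv ((H.index : ℝ)⁻¹ • fun y => ∑ c : G ⧸ H, actAlt ρ a c.out r (β (a c.out⁻¹ y))) x
      = ω x
    rw [extDeriv_smul, extDeriv_finset_sum Finset.univ fun c _ => hdF c.out]
    simp only [hterm, Finset.sum_const, Finset.card_univ]
    rw [← Nat.card_eq_fintype_card, ← Subgroup.index_eq_card, ← Nat.cast_smul_eq_nsmul ℝ,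
      inv_smul_smul₀ (Nat.cast_ne_zero.2 Subgroup.FiniteIndex.index_ne_zero)]

end Summit.Langlands.Langlands.Theorems.HeckeEigenvalueField.Res

end
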